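import Literature.IUT.HodgeArakelov.GlobalGaussianFrobenioids
import Literature.IUT.HodgeArakelov.GaussianMonoidsGood
import Literature.IUT.HodgeArakelov.ThetaGauLinks
import Literature.IUT.LogThetaLattice.LogLinkIterates
import Literature.IUT.LogThetaLattice.MultiradialityRemarks

/-!
# The Gaussian exponent vector `(1², 2², …, (l⋇)²)`: one notion, four spellings (bridge lemmas)

Merge-bookkeeping companion (abc-iut cell, layer L6; no new definitions). The exponent vector of the
`Θ^{×μ}_{gau}`-link, `q ↦ (q^{1²}, q^{2²}, …, q^{(l⋇)²})` — S. Mochizuki, *Inter-universal Teichmüller theory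
II*, kurims Dec-2020 manuscript, Remark 4.11.1 p. 164 ("`q ↦ q^{(1², 2², …, (l⋇)²)}`"), Corollary 4.5 (v)
p. 134 (the "vector of ratios" `(…, j²·, …)` of the global formal evaluation isomorphism), Proposition 4.1
(iv) p. 122 (`(…, j²·log(p_v), …)`); *III*, Remark 2.2.2 (i) p. 69 — was typed four times in the tree,
for the label with natural number `j = i + 1`, `i : Fin l⋇`:

* `Literature.IUT.HodgeArakelov.sqWeight` (GlobalGaussianFrobenioids, [IUTchII] Cor 4.5 (v)) — the
  CANONICAL spelling (L6 merge ruling on the `q^{j²}` vectors);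
* `Literature.IUT.HodgeArakelov.thetaExponent` (ThetaGauLinks, [IUTchII] Rmk 4.11.1);
* `Literature.IUT.HodgeArakelov.labelNat j ^ 2` inside `ConstantMonoidDatum.weight` (GaussianMonoidsGood,
  [IUTchII] Prop 4.1 (iv));
* `Literature.IUT.LogThetaLattice.gaussianExponents` (LogLinkIterates, [IUTchIII] Rmk 2.2.2 (i)) and
  `Literature.IUT.LogThetaLattice.MultiradialityRemarks.gaussianExponents` (MultiradialityRemarks, idem).

This file records that all of them are the same function (definitional equalities), so that downstream
files may rewrite any of them to `sqWeight`. Claim key `Mochizuki2012` DISPUTED (D-0012); nothing here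
asserts a disputed claim — these are identities between formalisations of one printed formula.
-/

namespace Literature.IUT.HodgeArakelov

open scoped NNReal

/-- [IUTchII] Rmk 4.11.1 p. 164 `q ↦ q^{(1², …, (l⋇)²)}` = Cor 4.5 (v) p. 134 "vector of ratios": the
exponent `thetaExponent i` of `ThetaGauLinks` IS `sqWeight l⋇ i`. [cite: Mochizuki2012, Rmk 4.11.1 p.164] -/
theorem thetaExponent_eq_sqWeight {lstar : ℕ} (i : Fin lstar) : thetaExponent i = sqWeight lstar i := rfl

/-- As functions `Fin l⋇ → ℕ`. [cite: Mochizuki2012, Rmk 4.11.1 p.164] -/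
theorem thetaExponent_eq_sqWeight' (lstar : ℕ) :
    (fun i : Fin lstar => thetaExponent i) = sqWeight lstar := rfl

/-- [IUTchII] Prop 4.1 (iv) p. 122 "the natural number determined by `j`", squared, is the weight `j²` of
Cor 4.5 (v) p. 134: `labelNat j ^ 2 = sqWeight l⋇ j`. [cite: Mochizuki2012, Prop 4.1 (iv) p.122] -/
theorem labelNat_sq_eq_sqWeight {lstar : ℕ} (j : Fin lstar) : labelNat j ^ 2 = sqWeight lstar j := rfl

/-- [IUTchII] Prop 4.1 (iv) p. 122: the `j`-th component `c · j² · log(p_v)` of the formal evaluation map of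
`GaussianMonoidsGood` written with the canonical weight: `weight c j = c · (sqWeight j · log(p_v))`.
[cite: Mochizuki2012, Prop 4.1 (iv) p.122] -/
theorem ConstantMonoidDatum.weight_eq_sqWeight (Ψ : ConstantMonoidDatum) (lstar : ℕ) (c : ℝ≥0)
    (j : Fin lstar) :
    Ψ.weight lstar c j = c * ((sqWeight lstar j : ℕ) * Ψ.logReal.logp) := by
  simp only [ConstantMonoidDatum.weight, ← labelNat_sq_eq_sqWeight, Nat.cast_pow]

end Literature.IUT.HodgeArakelov

namespace Literature.IUT.LogThetaLattice

open Literature.IUT.HodgeArakelov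

/-- [IUTchIII] Rmk 2.2.2 (i) p. 69 (= [IUTchII] Rmk 4.11.1): the exponent vector `gaussianExponents` of
`LogLinkIterates` IS `sqWeight`. [cite: Mochizuki2012, Rmk 4.11.1 p.164] -/
theorem gaussianExponents_eq_sqWeight (lstar : ℕ) : gaussianExponents lstar = sqWeight lstar := rfl

/-- [IUTchIII] Rmk 2.2.2 (i) p. 69 (= [IUTchII] Rmk 4.11.1): the exponent vector
`MultiradialityRemarks.gaussianExponents` IS `sqWeight`. [cite: Mochizuki2012, Rmk 4.11.1 p.164] -/
theorem MultiradialityRemarks.gaussianExponents_eq_sqWeight (lstar : ℕ) :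
    MultiradialityRemarks.gaussianExponents lstar = sqWeight lstar := rfl

/-- Hence the two [IUTchIII]-side spellings agree with each other. [cite: Mochizuki2012, Rmk 4.11.1 p.164] -/
theorem MultiradialityRemarks.gaussianExponents_eq (lstar : ℕ) :
    MultiradialityRemarks.gaussianExponents lstar = gaussianExponents lstar := rfl

/-- … and the [IUTchII]-side `thetaExponent` is their common value at each label.
[cite: Mochizuki2012, Rmk 4.11.1 p.164] -/
theorem gaussianExponents_apply_eq_thetaExponent {lstar : ℕ} (i : Fin lstar) :
    gaussianExponents lstar i = thetaExponent i := rfl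

end Literature.IUT.LogThetaLattice
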